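import Summits.CriticalPhenomena.SAWScalingLimit.Theorems.SAWExcursionCardySimpleSubseqLimitsSplit
import Summits.CriticalPhenomena.SAWScalingLimit.Theses.SAWStressTensor
import HarnessLib

/-!
# Split glue for the crux `SimpleSubseqLimits` (stmt-CriticalPhenomena-4514) on route SAWStressTensor:
# `SeqSlitAvoidance → RangeArc → SimpleSubseqLimits` (crux strategist, BC2-redirect seat, 2026-08-17)

Route SAWStressTensor wants the shared crux item stmt-CriticalPhenomena-4514 under its own decl
`SAWStressTensor.SimpleSubseqLimits`, whose text is the landed core `Negative.SimpleSubseqLimitsCore` verbatim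
(`stressTensor_iff_core`, `Iff.rfl`). The ORDER/SHAPE split of the crux (children `SeqSlitAvoidance` = the text of
stmt-CriticalPhenomena-18169, and `LimitRangeArc` = `PastShadowing.Main.RangeArc`, value-free SHAPE) is glued route-neutrally by
`ArcSplitEC.core_of_seqSlitAvoidance_rangeArc` (`SAWExcursionCardySimpleSubseqLimitsSplit.lean`: lead c9's soft
transfer p153873 and closing p154999 re-hosted on `RangeArc`); this file only states the glue BY NAME and BY
TEXT for this route, for `ledger route edit route-CriticalPhenomena-SAWStressTensor --split SimpleSubseqLimits --glue-by`.
[folklore]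
-/

namespace Summit.CriticalPhenomena.SAWScalingLimit.Theorems.SimpleSubseqLimits.SlitRestriction.ArcSplitEC

open Summit.CriticalPhenomena.SAWScalingLimit.Theorems.SimpleSubseqLimits.Negative (SimpleSubseqLimitsCore)
open Summit.CriticalPhenomena.SAWScalingLimit.Theorems.SimpleSubseqLimits.SlitRestriction.Transfer
  (SequentialSlitAvoidance)
open Summit.CriticalPhenomena.SAWScalingLimit.Theorems.SimpleSubseqLimits.PastShadowing.Main (RangeArc)

/-- The route decl `SAWStressTensor.SimpleSubseqLimits` (shared item stmt-CriticalPhenomena-4514) IS the landed core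
`Negative.SimpleSubseqLimitsCore` (definitional). [folklore] -/
theorem stressTensor_iff_core :
    Summit.CriticalPhenomena.SAWScalingLimit.Theses.SAWStressTensor.SimpleSubseqLimits ↔ SimpleSubseqLimitsCore :=
  Iff.rfl

/-- **The crux of route SAWStressTensor from the two inputs** (by name). [folklore] -/
theorem stressTensor_of_seqSlitAvoidance_rangeArc (h₁ : SequentialSlitAvoidance) (h₂ : RangeArc) :
    Summit.CriticalPhenomena.SAWScalingLimit.Theses.SAWStressTensor.SimpleSubseqLimits :=
  stressTensor_iff_core.2 (core_of_seqSlitAvoidance_rangeArc h₁ h₂)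

/-- **SPLIT GLUE** for `ledger route edit route-CriticalPhenomena-SAWStressTensor --split SimpleSubseqLimits --glue-by`:
child 1 (`SeqSlitAvoidance`, ORDER; = stmt-CriticalPhenomena-18169) → child 2 (`LimitRangeArc`, SHAPE, value-free,
a consequence of the crux) → the crux BY NAME (registered stub `stressTensor_of_arcSubs` of stmt-4514). [folklore] -/
theorem stressTensor_of_arcSubs : ((∀ (D : Literature.Probability.RandomPlanarGeometry.DobrushinDomain) (a b : ℝ → Literature.Probability.LatticeModels.Site 2), Literature.Probability.RandomPlanarGeometry.SAW.IsEndpointApprox D a b → ∀ (π : Literature.Probability.RandomPlanarGeometry.Curve ℂ) (q : ℂ) (ρ R : ℝ), 0 < ρ → ρ < R → ((π 1 ∈ Metric.closedBall q ρ) ∧ Set.range (fun u : unitInterval => π u) ⊆ closure D.carrier ∧ ∃ e : C(unitInterval, ℂ), Function.Injective e ∧ Set.range e = Set.range (fun u : unitInterval => π u) ∧ e 0 = D.pt 0 ∧ ∀ u : unitInterval, e u ∈ frontier D.carrier → u = 0) → ∀ θ : ℝ, 0 < θ → ∃ ε : ℝ, 0 < ε ∧ ∀ (s : ℕ → ℝ)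 (t : ℕ → Literature.Probability.LatticeModels.Site 2) (ω : ∀ n : ℕ, Literature.Probability.RandomPlanarGeometry.SAW.DomainSAW D.carrier (s n) (a (s n)) (t n)), Filter.Tendsto s Filter.atTop (nhdsWithin 0 (Set.Ioi 0)) → (∀ n : ℕ, Literature.Probability.LatticeModels.meshPoint (s n) (t n) ∈ Metric.closedBall q ρ) → (∀ n : ℕ, ∀ x ∈ (ω n).walk.support.dropLast, Literature.Probability.LatticeModels.meshPoint (s n) x ∉ Metric.closedBall q ρ) → Filter.Tendsto (fun n => (ω n).curve) Filter.atTop (nhds (Literature.Probability.RandomPlanarGeometry.CurveClass.mk π)) → ∀ᶠ n in Filter.atTop, Literature.Probability.RandomPlanarGeometry.SAW.law D.carrier (s n) (a (s n)) (b (s n)) {γ : Literature.Probability.RandomPlanarGeometry.SAW.DomainSAW D.carrier (s n) (a (s n)) (b (s n)) | γ.walk.support.take ((ω n).length + 1) = (ω n).walk.support ∧ ∃ j : ℕ, (ω n).length ≤ j ∧ j ≤ γ.length ∧ ∃ z ∈ ((fun u : unitInterval => π u) '' {u : unitInterval | ∀ u' : unitInterval, u' ≤ u → R < dist (π u') q}),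 dist (Literature.Probability.LatticeModels.meshPoint (s n) (γ.walk.getVert j)) z < ε} ≤ ENNReal.ofReal θ * Literature.Probability.RandomPlanarGeometry.SAW.law D.carrier (s n) (a (s n)) (b (s n)) {γ : Literature.Probability.RandomPlanarGeometry.SAW.DomainSAW D.carrier (s n) (a (s n)) (b (s n)) | γ.walk.support.take ((ω n).length + 1) = (ω n).walk.support})) → ((∀ (D : Literature.Probability.RandomPlanarGeometry.DobrushinDomain) (a b : ℝ → Literature.Probability.LatticeModels.Site 2), Literature.Probability.RandomPlanarGeometry.SAW.IsEndpointApprox D a b → ∀ (s : ℕ → ℝ) (ν : MeasureTheory.Measure (Literature.Probability.RandomPlanarGeometry.CurveClass ℂ)), Filter.Tendsto s Filter.atTop (nhdsWithin 0 (Set.Ioi 0)) → MeasureTheory.IsProbabilityMeasure ν → (∀ f : BoundedContinuousFunction (Literature.Probability.RandomPlanarGeometry.CurveClass ℂ) ℝ, Filter.Tendsto (fun n => ∫ γ, f γ.curve ∂(Literature.Probability.RandomPlanarGeometry.SAW.law D.carrier (s n) (a (s n)) (b (s n)))) Filter.atTop (nhds (∫ x, f x ∂ν))) → ∀ᵐ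 γ ∂ν, (∃ e : C(unitInterval, ℂ), Function.Injective e ∧ Set.range e = γ.range ∧ e 0 = D.pt 0 ∧ e 1 = D.pt 1) ∧ γ.range ∩ frontier D.carrier ⊆ {D.pt 0, D.pt 1})) →
    Summit.CriticalPhenomena.SAWScalingLimit.Theses.SAWStressTensor.SimpleSubseqLimits :=
  fun h₁ h₂ => stressTensor_of_seqSlitAvoidance_rangeArc (seqSlitText_iff.1 h₁) (rangeArcText_iff.1 h₂)

/-- **SHAPE is a consequence of the crux of route SAWStressTensor.** [folklore] -/
theorem rangeArc_of_stressTensor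
    (h : Summit.CriticalPhenomena.SAWScalingLimit.Theses.SAWStressTensor.SimpleSubseqLimits) : RangeArc :=
  rangeArc_of_core (stressTensor_iff_core.1 h)

end Summit.CriticalPhenomena.SAWScalingLimit.Theorems.SimpleSubseqLimits.SlitRestriction.ArcSplitEC
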